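import Mathlib
import Literature.NumberTheory.GaloisRepresentations.GaloisRep
import Summits.Langlands.Langlands.Theorems.PhantomRMYoshidaResiduallyYoshidaLiftingResidualSplitting

/-!
# Trace limits VII' — integral models: traces, characteristic polynomials, reduction (route
# `PhantomRMYoshida`, crux `ResiduallyYoshidaLifting` = stmt-Langlands-13639, line
# `endoscopic-crossing-euler`, Stub 4)

Bookkeeping for the endo-removal assembly (`…TraceLimitRemoval.lean`, `--supports stmt-Langlands-13639`):
for an integral model `A : Γ_ℚ → GL_m(ℤ̄_p)` of a continuous `r : Γ_ℚ → GL_m(ℚ̄_p)`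
(`A(g) = P⁻¹ r(g) P`, tree `exists_integralModel_of_valuationSubring`),

* `coe_trace_of_integralModel`, `map_charpoly_of_integralModel` (registered as
  `stub_integralModelCharpoly`) — `tr A(g) = tr r(g)` and `det(X - A(g)) = det(X - r(g))` in `ℚ̄_p`;
* `map_red_eq_of_norm_coeff_sub_lt_one` — two polynomials over `ℤ̄_p` which are coefficientwise at
  distance `< 1` in `ℚ̄_p` have the same image under any `red : ℤ̄_p → k` of characteristic `p`
  (landed `red_eq_zero_of_norm_lt_one`).

References: J.-P. Serre, *Abelian ℓ-adic representations* (1968), I §1.1.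
-/

noncomputable section

open scoped Matrix

namespace Summit.Langlands.Langlands.Cruxes.ResiduallyYoshidaLifting.EndoscopicCrossingEuler

set_option linter.dupNamespace false

open Literature.NumberTheory.GaloisRepresentations

variable {p : ℕ} [Fact p.Prime]

/-- The matrix of `map 𝒪.subtype u` is the entrywise image of the matrix of `u`. [folklore] -/
theorem coe_map_subtype_apply {m : ℕ} (u : GL (Fin m) (Valued.integer (PadicAlgCl p))) :
    (((Matrix.GeneralLinearGroup.map (Valued.integer (PadicAlgCl p)).subtype u) : GL (Fin m) (PadicAlgCl p)) :
        Matrix (Fin m) (Fin m) (PadicAlgCl p)) =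
      ((u : GL (Fin m) (Valued.integer (PadicAlgCl p))) :
        Matrix (Fin m) (Fin m) (Valued.integer (PadicAlgCl p))).map (Valued.integer (PadicAlgCl p)).subtype := rfl

/-- Trace of a conjugate integral model: `tr A(g) = tr r(g)` in `ℚ̄_p`. [folklore] -/
theorem coe_trace_of_integralModel {m : ℕ} {r : FramedGaloisRep ℚ (PadicAlgCl p) m}
    {P : GL (Fin m) (PadicAlgCl p)}
    {A : Field.absoluteGaloisGroup ℚ →* GL (Fin m) (Valued.integer (PadicAlgCl p))}
    (hA : ∀ g, Matrix.GeneralLinearGroup.map (Valued.integer (PadicAlgCl p)).subtype (A g) = P⁻¹ * r g * P)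
    (g : Field.absoluteGaloisGroup ℚ) :
    ((((A g : GL (Fin m) (Valued.integer (PadicAlgCl p))) :
          Matrix (Fin m) (Fin m) (Valued.integer (PadicAlgCl p))).trace : Valued.integer (PadicAlgCl p)) :
        PadicAlgCl p) =
      ((r g : GL (Fin m) (PadicAlgCl p)) : Matrix (Fin m) (Fin m) (PadicAlgCl p)).trace := by
  have h3 := congrArg (fun u : GL (Fin m) (PadicAlgCl p) => (u : Matrix (Fin m) (Fin m) (PadicAlgCl p)).trace) (hA g)
  rw [coe_map_subtype_apply, ← AddMonoidHom.map_trace, Units.val_mul, Units.val_mul,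
    Matrix.trace_units_conj'] at h3
  exact h3

/-- Characteristic polynomial of a conjugate integral model: `det(X - A(g)) = det(X - r(g))` over
`ℚ̄_p`. [folklore] -/
theorem map_charpoly_of_integralModel {m : ℕ} {r : FramedGaloisRep ℚ (PadicAlgCl p) m}
    {P : GL (Fin m) (PadicAlgCl p)}
    {A : Field.absoluteGaloisGroup ℚ →* GL (Fin m) (Valued.integer (PadicAlgCl p))}
    (hA : ∀ g, Matrix.GeneralLinearGroup.map (Valued.integer (PadicAlgCl p)).subtype (A g) = P⁻¹ * r g * P)
    (g : Field.absoluteGaloisGroup ℚ) :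
    (((A g : GL (Fin m) (Valued.integer (PadicAlgCl p))) :
        Matrix (Fin m) (Fin m) (Valued.integer (PadicAlgCl p))).charpoly).map (Valued.integer (PadicAlgCl p)).subtype =
      ((r g : GL (Fin m) (PadicAlgCl p)) : Matrix (Fin m) (Fin m) (PadicAlgCl p)).charpoly := by
  have h3 := congrArg (fun u : GL (Fin m) (PadicAlgCl p) => (u : Matrix (Fin m) (Fin m) (PadicAlgCl p)).charpoly) (hA g)
  rwa [coe_map_subtype_apply, Matrix.charpoly_map, Units.val_mul, Units.val_mul, Matrix.coe_units_inv,
    Matrix.charpoly_units_conj'] at h3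

/-- Two polynomials over `ℤ̄_p` whose images in `ℚ̄_p[X]` are coefficientwise at distance `< 1` have the
same image under any `red : ℤ̄_p → k` of characteristic `p` (tree `red_eq_zero_of_norm_lt_one`).
[folklore] -/
theorem map_red_eq_of_norm_coeff_sub_lt_one {k : Type} [Field k] [CharP k p]
    (red : Valued.integer (PadicAlgCl p) →+* k) (F G : Polynomial (Valued.integer (PadicAlgCl p)))
    (h : ∀ i, ‖(F.map (Valued.integer (PadicAlgCl p)).subtype).coeff i -
      (G.map (Valued.integer (PadicAlgCl p)).subtype).coeff i‖ < 1) :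
    F.map red = G.map red := by
  refine Polynomial.ext fun i => ?_
  rw [Polynomial.coeff_map, Polynomial.coeff_map, ← sub_eq_zero, ← map_sub]
  refine red_eq_zero_of_norm_lt_one red _ ?_
  have := h i
  rwa [Polynomial.coeff_map, Polynomial.coeff_map, ← map_sub] at this

/-- **Registered sub-goal `stub_integralModelCharpoly` of Stub 4** (the statement through which this
helper file lands, `--supports stmt-Langlands-13639`; = `map_charpoly_of_integralModel` in closed form).
[folklore] -/
theorem stub_integralModelCharpoly :
    ∀ (p : ℕ) [Fact p.Prime] (m : ℕ)
      (r : Literature.NumberTheory.GaloisRepresentations.FramedGaloisRep ℚ (PadicAlgCl p) m)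
      (P : GL (Fin m) (PadicAlgCl p))
      (A : Field.absoluteGaloisGroup ℚ →* GL (Fin m) (Valued.integer (PadicAlgCl p))),
      (∀ g, Matrix.GeneralLinearGroup.map (Valued.integer (PadicAlgCl p)).subtype (A g) = P⁻¹ * r g * P) →
      ∀ g, ((A g).val.charpoly).map (Valued.integer (PadicAlgCl p)).subtype = (r g).val.charpoly :=
  fun _ _ _ _ _ _ hA g => map_charpoly_of_integralModel hA g

end Summit.Langlands.Langlands.Cruxes.ResiduallyYoshidaLifting.EndoscopicCrossingEuler

end
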